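import Mathlib.Data.Finset.Sort
import Mathlib.Data.Sym.Sym2
import Mathlib.MeasureTheory.Integral.Bochner.Basic
import Literature.Analysis.FluidPDE.HardSphereDynamics
import HarnessLib

/-!
# Backward clusters and recollisions of a tagged hard sphere

Aoki–Pulvirenti–Simonella–Tsuji (M3AS 25 (2015) = arXiv:1408.6571, §1 and §5) and
Pulvirenti–Simonella (DCDS 41 (2021) = arXiv:2005.09962, §1.1) attach to a tagged particle `i`
of an `N`-hard-sphere trajectory `γ` and a time `t` its **backward cluster** `BC(i) ⊆ {1,…,N}`:
"going back in time starting from `z_i(t)`, let `i₁` be the first particle colliding with `i`;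
next, considering the two particles `i` and `i₁`, go back in time up to the first collision of
one of the pair with a new particle `i₂`; iterate this procedure up to time `0`. Then
`BC(i) := {i₁, …, iₙ}`" (`i ∉ BC(i)`, APST §5). "Collisions which do not involve a new particle
are called **recollisions**" (PS 2021 §1.1). APST §5 computes `BC(i)` from the *collision
record* `{t_m}, {(p_m, q_m)}` of the trajectory; this file formalises exactly that procedure,
for the hard-sphere trajectories / flows of `Literature.Analysis.FluidPDE.HardSphereDynamics`
(`IsHardSphereTrajectory`, `HardSphereFlow`), over an arbitrary time window `(s, t]`.

* `contactPairSet G ε z` — the unordered pairs `{j, k}`, `j ≠ k`, in contact in the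
  configuration `z` (the *event* of `z`); for a hard-sphere trajectory at a collision time it is
  the singleton `{{p, q}}` of the colliding pair
  (`IsHardSphereTrajectory.contactPairSet_eq_singleton`).
* `clusterStep E S`, `recollisionStep E S`, `sweepStep`, `sweep` — the elementary backward step:
  given the running cluster `S` (tagged particle included) and an event `E`, the partners in `E`
  of members of `S` join `S`, and the pairs of `E` *inside* `S` are counted as recollisions;
  `sweep` folds this over a list of events given in increasing time (processed latest first).
* `collisionWindow G ε γ s t` — the (finite) set of collision times of `γ` in `(s, t]`;
  `collisionEvents` — their events in increasing time; `collisionRecord` — the finite set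
  `{(τ, {p, q})}` of collisions in the window (item (a) of the request).
* `backwardSweep`, **`backwardCluster G ε γ i s t : Finset (Fin N)`** (item (b)) and
  **`recollisionCount G ε γ i s t : ℕ`** (item (c)): the backward cluster of `i` built from the
  collisions in `(s, t]`, processed backwards from `t` down to `s`, and the number of those
  collisions both of whose particles already belong to the running cluster.
* flow versions `HardSphereFlow.backwardCluster Φ i s t z`, `HardSphereFlow.recollisionCount`
  (functions of the initial datum `z`, along `τ ↦ Φ_τ z`; junk `∅` / `0` off the good set),
  the windows "last `M` mean free times" `(t - M/α, t]` (`recentBackwardCluster`,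
  `recentRecollisionCount`) and the averages `⟨K⟩_t` (`meanBackwardClusterCard`,
  `meanRecollisionCount`, APST §1) under an initial law.

## Conventions

* Trajectories of the tree are right-continuous (`γ τ` is post-collisional), so the collision
  at time `τ` influences `γ τ`; the window of `backwardCluster G ε γ i s t` is `(s, t]`: a
  collision at the final time `t` counts, one at the initial time `s` does not (it happened
  "before the start"; for the flow from an initial datum at time `0` this is the Liouville-null
  event `z ∈ ∂D_ε^N`). Windows compose: `(s, u] ∪ (u, t]`.
* Several pairs in contact at the same time (excluded for hard-sphere trajectories by
  `IsHardSphereTrajectory.binary`, allowed for a general curve) are processed simultaneously: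
  all partners of current members join, which is the reading of the printed rule with strictly
  decreasing collision times along an influence chain.
* Junk values: if `γ` has infinitely many collision times in `(s, t]` the window is `∅`
  (cluster `∅`, no recollisions); this never happens for hard-sphere trajectories
  (`IsHardSphereTrajectory.locFinite`).

## What is not here

Measurability of `z ↦ Φ.backwardCluster i s t z` on the good set of a `HardSphereFlow` (by
dyadic sampling of the velocities) is proved in a separate file; the growth estimates of
APST Thm 3.1 / PS 2021 Thm 2.1 (`⟨K⟩_t` grows exponentially; `P(|BC| = k)` bounds) are not
vendored here.

## References

* K. Aoki, M. Pulvirenti, S. Simonella, T. Tsuji, *Backward clusters, hierarchy and wild sums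
  for a hard sphere system in a low-density regime*, M3AS 25 (2015) 995–1010, §1, §5.
* M. Pulvirenti, S. Simonella, *On the cardinality of collisional clusters for hard spheres at
  low density*, DCDS 41 (2021) 3903–3914, §1.1.
-/

open Set
open _root_.MeasureTheory

namespace Literature.MathematicalPhysics.KineticTheory

noncomputable section

open Literature.Analysis.FluidPDE

variable {d : Type*} [Fintype d] {X : Type*} {N : ℕ}

/-! ## Events: the pairs in contact in a configuration -/

open scoped Classical in
/-- The *event* of a configuration `z`: the set of unordered pairs `{j, k}` of distinct particles
in contact in `z` (`|x_j - x_k| = ε`, `Kinetic.contactSet`, in either order). Along a hard-sphere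
trajectory this is nonempty exactly at the collision times, where it is the colliding pair
(APST 2015 §5: the record `(p_m, q_m)` of the pair colliding at time `t_m`).
[cite: AokiPulvirentiSimonellaTsuji2015, §5] -/
def contactPairSet (G : Geometry d X) (ε : ℝ) (z : Config N d X) : Finset (Sym2 (Fin N)) :=
  (Finset.univ.filter fun p : Fin N × Fin N => p.1 ≠ p.2 ∧ z ∈ contactSet G N ε p.1 p.2).image
    fun p => s(p.1, p.2)

/-- Membership in the event of a configuration. [folklore] -/
theorem mem_contactPairSet {G : Geometry d X} {ε : ℝ} {z : Config N d X} {j k : Fin N} :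
    s(j, k) ∈ contactPairSet G ε z ↔
      j ≠ k ∧ (z ∈ contactSet G N ε j k ∨ z ∈ contactSet G N ε k j) := by
  classical
  constructor
  · intro h
    obtain ⟨p, hp, hpe⟩ := Finset.mem_image.1 h
    obtain ⟨hne, hc⟩ := (Finset.mem_filter.1 hp).2
    rcases Sym2.eq_iff.1 hpe with ⟨rfl, rfl⟩ | ⟨rfl, rfl⟩
    · exact ⟨hne, Or.inl hc⟩
    · exact ⟨fun h => hne h.symm, Or.inr hc⟩
  · rintro ⟨hjk, hc | hc⟩
    · exact Finset.mem_image.2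
        ⟨(j, k), Finset.mem_filter.2 ⟨Finset.mem_univ _, hjk, hc⟩, rfl⟩
    · exact Finset.mem_image.2
        ⟨(k, j), Finset.mem_filter.2 ⟨Finset.mem_univ _, fun h => hjk h.symm, hc⟩, Sym2.eq_swap⟩

/-- Events contain no diagonal pair. [folklore] -/
theorem not_isDiag_of_mem_contactPairSet {G : Geometry d X} {ε : ℝ} {z : Config N d X}
    {e : Sym2 (Fin N)} : e ∈ contactPairSet G ε z → ¬ e.IsDiag := by
  induction e using Sym2.ind with
  | h j k => exact fun he hd => (mem_contactPairSet.1 he).1 (Sym2.mk_isDiag_iff.1 hd)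

/-- The event of `z` is empty iff no two distinct particles are in contact, i.e. iff `z` is not
a contact configuration in the sense of `Kinetic.collisionTimes`. [folklore] -/
theorem contactPairSet_eq_empty_iff {G : Geometry d X} {ε : ℝ} {z : Config N d X} :
    contactPairSet G ε z = ∅ ↔ ∀ j k : Fin N, j ≠ k → z ∉ contactSet G N ε j k := by
  rw [Finset.eq_empty_iff_forall_notMem]
  constructor
  · intro h j k hjk hc
    exact h _ (mem_contactPairSet.2 ⟨hjk, Or.inl hc⟩)
  · intro h e
    induction e using Sym2.ind with
    | h j k =>
      intro he
      obtain ⟨hjk, hc | hc⟩ := mem_contactPairSet.1 he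
      · exact h j k hjk hc
      · exact h k j (fun h' => hjk h'.symm) hc

/-- A time is a collision time of `γ` iff the event of `γ τ` is nonempty. [folklore] -/
theorem mem_collisionTimes_iff_contactPairSet_nonempty {G : Geometry d X} {ε : ℝ}
    {γ : ℝ → Config N d X} {τ : ℝ} :
    τ ∈ collisionTimes G ε γ ↔ (contactPairSet G ε (γ τ)).Nonempty := by
  rw [mem_collisionTimes, Finset.nonempty_iff_ne_empty, Ne, contactPairSet_eq_empty_iff]
  simp only [not_forall, not_not, exists_prop]

/-! ## The elementary backward step and the sweep over a list of events -/

open scoped Classical in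
/-- One backward step of the cluster construction: given the running cluster `S` (the tagged
particle together with the particles that have joined so far) and the event `E` of the next
collision going back in time, every partner in `E` of a member of `S` joins ("the first
collision of one particle of the group with a new particle", APST 2015 §1).
[cite: AokiPulvirentiSimonellaTsuji2015, §1] -/
def clusterStep (E : Finset (Sym2 (Fin N))) (S : Finset (Fin N)) : Finset (Fin N) :=
  S ∪ Finset.univ.filter fun k => ∃ j ∈ S, s(j, k) ∈ E

open scoped Classical in
/-- The recollisions of one backward step: the pairs of the event `E` both of whose particles
already belong to the running cluster `S` ("collisions which do not involve a new particle are
called recollisions", PS 2021 §1.1). [cite: PulvirentiSimonella2021, §1.1] -/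
def recollisionStep (E : Finset (Sym2 (Fin N))) (S : Finset (Fin N)) : ℕ :=
  (E.filter fun e => ∀ j ∈ e, j ∈ S).card

/-- One backward step on the pair (running cluster, recollision count). [folklore] -/
def sweepStep (E : Finset (Sym2 (Fin N))) (p : Finset (Fin N) × ℕ) : Finset (Fin N) × ℕ :=
  (clusterStep E p.1, p.2 + recollisionStep E p.1)

/-- The backward sweep over a list of events given in *increasing* time: the events are
processed from the last (latest) to the first, starting from `init` (APST 2015 §1, §5: iterate
the backward step down to the initial time). [cite: AokiPulvirentiSimonellaTsuji2015, §1, §5] -/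
def sweep (Es : List (Finset (Sym2 (Fin N)))) (init : Finset (Fin N) × ℕ) : Finset (Fin N) × ℕ :=
  Es.foldr sweepStep init

/-- Membership in the result of a backward step. [folklore] -/
theorem mem_clusterStep {E : Finset (Sym2 (Fin N))} {S : Finset (Fin N)} {k : Fin N} :
    k ∈ clusterStep E S ↔ k ∈ S ∨ ∃ j ∈ S, s(j, k) ∈ E := by
  classical
  simp [clusterStep]

/-- The running cluster only grows. [folklore] -/
theorem subset_clusterStep (E : Finset (Sym2 (Fin N))) (S : Finset (Fin N)) :
    S ⊆ clusterStep E S := fun _ hk => mem_clusterStep.2 (Or.inl hk)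

/-- An empty event changes nothing. [folklore] -/
@[simp]
theorem clusterStep_empty (S : Finset (Fin N)) : clusterStep ∅ S = S := by
  ext k
  simp [mem_clusterStep]

/-- An empty event has no recollision. [folklore] -/
@[simp]
theorem recollisionStep_empty (S : Finset (Fin N)) : recollisionStep ∅ S = 0 := by
  classical
  simp [recollisionStep]

/-- The number of recollisions of a step is at most the number of pairs of the event. [folklore] -/
theorem recollisionStep_le_card (E : Finset (Sym2 (Fin N))) (S : Finset (Fin N)) :
    recollisionStep E S ≤ E.card := by
  classical
  exact Finset.card_filter_le _ _

/-- An empty event is a trivial step. [folklore] -/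
@[simp]
theorem sweepStep_empty (p : Finset (Fin N) × ℕ) : sweepStep ∅ p = p := by
  simp [sweepStep]

/-- The sweep over no event. [folklore] -/
@[simp]
theorem sweep_nil (init : Finset (Fin N) × ℕ) : sweep [] init = init := rfl

/-- The sweep processes the head of the list last. [folklore] -/
@[simp]
theorem sweep_cons (E : Finset (Sym2 (Fin N))) (Es : List (Finset (Sym2 (Fin N))))
    (init : Finset (Fin N) × ℕ) : sweep (E :: Es) init = sweepStep E (sweep Es init) := rfl

/-- Sweeping over a concatenation: the later events (the second list) are processed first.
[folklore] -/
theorem sweep_append (Es Es' : List (Finset (Sym2 (Fin N)))) (init : Finset (Fin N) × ℕ) :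
    sweep (Es ++ Es') init = sweep Es (sweep Es' init) :=
  List.foldr_append

/-- Along a sweep the running cluster only grows. [folklore] -/
theorem fst_subset_sweep_fst (Es : List (Finset (Sym2 (Fin N)))) (init : Finset (Fin N) × ℕ) :
    init.1 ⊆ (sweep Es init).1 := by
  induction Es with
  | nil => exact Finset.Subset.refl _
  | cons E Es ih => exact ih.trans (subset_clusterStep E _)

/-- Along a sweep the recollision count only grows. [folklore] -/
theorem snd_le_sweep_snd (Es : List (Finset (Sym2 (Fin N)))) (init : Finset (Fin N) × ℕ) :
    init.2 ≤ (sweep Es init).2 := by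
  induction Es with
  | nil => exact le_rfl
  | cons E Es ih => exact ih.trans (Nat.le_add_right _ _)

/-- Empty events may be dropped from a sweep. [folklore] -/
theorem sweep_filter_ne_empty (Es : List (Finset (Sym2 (Fin N)))) (init : Finset (Fin N) × ℕ) :
    sweep (Es.filter fun E => E ≠ ∅) init = sweep Es init := by
  induction Es with
  | nil => rfl
  | cons E Es ih =>
    by_cases hE : E = ∅
    · subst hE
      rw [List.filter_cons_of_neg (by simp), sweep_cons, sweepStep_empty, ih]
    · rw [List.filter_cons_of_pos (by simpa using hE), sweep_cons, sweep_cons, ih]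

/-! ## The collision window and the collision record of a curve -/

open scoped Classical in
/-- The collision times of the curve `γ` in the window `(s, t]`, as a finite set (junk value `∅`
if there are infinitely many; for a hard-sphere trajectory there are finitely many,
`IsHardSphereTrajectory.locFinite`) (APST 2015 §5: the instants `t_1 < ⋯ < t_{m_c}` of the
pair collisions). [cite: AokiPulvirentiSimonellaTsuji2015, §5] -/
def collisionWindow (G : Geometry d X) (ε : ℝ) (γ : ℝ → Config N d X) (s t : ℝ) : Finset ℝ :=
  if h : (collisionTimes G ε γ ∩ Ioc s t).Finite then h.toFinset else ∅

/-- Membership in the collision window, when the collision times in `(s, t]` are finitely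
many. [folklore] -/
theorem mem_collisionWindow {G : Geometry d X} {ε : ℝ} {γ : ℝ → Config N d X} {s t : ℝ}
    (hfin : (collisionTimes G ε γ ∩ Ioc s t).Finite) {τ : ℝ} :
    τ ∈ collisionWindow G ε γ s t ↔ τ ∈ collisionTimes G ε γ ∧ τ ∈ Ioc s t := by
  rw [collisionWindow, dif_pos hfin, Set.Finite.mem_toFinset, mem_inter_iff]

/-- Every element of the collision window is a collision time in `(s, t]` (unconditionally).
[folklore] -/
theorem mem_of_mem_collisionWindow {G : Geometry d X} {ε : ℝ} {γ : ℝ → Config N d X}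
    {s t τ : ℝ} (hτ : τ ∈ collisionWindow G ε γ s t) :
    τ ∈ collisionTimes G ε γ ∧ τ ∈ Ioc s t := by
  by_cases hfin : (collisionTimes G ε γ ∩ Ioc s t).Finite
  · exact (mem_collisionWindow hfin).1 hτ
  · simp [collisionWindow, dif_neg hfin] at hτ

/-- An empty window has no collision time. [folklore] -/
theorem collisionWindow_eq_empty_of_le {G : Geometry d X} {ε : ℝ} {γ : ℝ → Config N d X}
    {s t : ℝ} (hts : t ≤ s) : collisionWindow G ε γ s t = ∅ := by
  have h : collisionTimes G ε γ ∩ Ioc s t = ∅ := by rw [Ioc_eq_empty (not_lt.2 hts), inter_empty]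
  rw [collisionWindow, dif_pos (by rw [h]; exact finite_empty)]
  simp [h]

/-- The events of the collisions of `γ` in `(s, t]`, listed in increasing time
(APST 2015 §5: the record `(p_m, q_m)`, `m = 1, …, m_c`).
[cite: AokiPulvirentiSimonellaTsuji2015, §5] -/
def collisionEvents (G : Geometry d X) (ε : ℝ) (γ : ℝ → Config N d X) (s t : ℝ) :
    List (Finset (Sym2 (Fin N))) :=
  ((collisionWindow G ε γ s t).sort).map fun τ => contactPairSet G ε (γ τ)

/-- The number of collision events in `(s, t]` is the number of collision times there. [folklore] -/
@[simp]
theorem length_collisionEvents (G : Geometry d X) (ε : ℝ) (γ : ℝ → Config N d X) (s t : ℝ) :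
    (collisionEvents G ε γ s t).length = (collisionWindow G ε γ s t).card := by
  simp [collisionEvents]

open scoped Classical in
/-- The *collision record* of `γ` in the window `(s, t]`: the finite set of collisions
`(τ, {p, q})` — a collision time `τ ∈ (s, t]` together with a pair in contact at that time
(APST 2015 §5: `{t_m}` and `{(p_m, q_m)}`). [cite: AokiPulvirentiSimonellaTsuji2015, §5] -/
def collisionRecord (G : Geometry d X) (ε : ℝ) (γ : ℝ → Config N d X) (s t : ℝ) :
    Finset (ℝ × Sym2 (Fin N)) :=
  (collisionWindow G ε γ s t ×ˢ Finset.univ).filter fun e => e.2 ∈ contactPairSet G ε (γ e.1)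

/-- Membership in the collision record. [folklore] -/
theorem mem_collisionRecord {G : Geometry d X} {ε : ℝ} {γ : ℝ → Config N d X} {s t : ℝ}
    {e : ℝ × Sym2 (Fin N)} :
    e ∈ collisionRecord G ε γ s t ↔
      e.1 ∈ collisionWindow G ε γ s t ∧ e.2 ∈ contactPairSet G ε (γ e.1) := by
  classical
  simp [collisionRecord]

/-! ## The backward cluster and the recollision count of a tagged particle -/

/-- The backward sweep of the tagged particle `i` over the collisions of `γ` in `(s, t]`: the
pair (running cluster including `i`, number of recollisions) after processing all collisions
from time `t` back to time `s` (APST 2015 §1, §5; PS 2021 §1.1).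
[cite: AokiPulvirentiSimonellaTsuji2015, §1, §5] -/
def backwardSweep (G : Geometry d X) (ε : ℝ) (γ : ℝ → Config N d X) (i : Fin N) (s t : ℝ) :
    Finset (Fin N) × ℕ :=
  sweep (collisionEvents G ε γ s t) ({i}, 0)

/-- The **backward cluster** `BC(i)` of the tagged particle `i` along the curve `γ` over the time
window `(s, t]`: going back in time from `γ t`, the first particle `i₁` colliding with `i`
joins, then the first new particle colliding with one of `{i, i₁}`, and so on down to time `s`;
`BC(i) = {i₁, …, iₙ}` does not contain `i` (APST 2015 §1 and §5, window `(0, t]`; PS 2021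
§1.1). [cite: AokiPulvirentiSimonellaTsuji2015, §1] -/
def backwardCluster (G : Geometry d X) (ε : ℝ) (γ : ℝ → Config N d X) (i : Fin N) (s t : ℝ) :
    Finset (Fin N) :=
  (backwardSweep G ε γ i s t).1.erase i

/-- The **number of recollisions** of the backward cluster of `i` over `(s, t]`: the collisions
in the window both of whose particles already belong to the running backward cluster when they
happen, i.e. the collisions of the cluster trajectory "which do not involve a new particle"
(PS 2021 §1.1). [cite: PulvirentiSimonella2021, §1.1] -/
def recollisionCount (G : Geometry d X) (ε : ℝ) (γ : ℝ → Config N d X) (i : Fin N)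
    (s t : ℝ) : ℕ :=
  (backwardSweep G ε γ i s t).2

/-- The backward cluster over the last `M` mean free times before `t`: the window
`(t - M/α, t]`, `α` the collision rate (mean free time `1/α`). [folklore] -/
def recentBackwardCluster (G : Geometry d X) (ε : ℝ) (γ : ℝ → Config N d X) (α M : ℝ)
    (i : Fin N) (t : ℝ) : Finset (Fin N) :=
  backwardCluster G ε γ i (t - M / α) t

/-- The recollision count over the last `M` mean free times before `t` (window
`(t - M/α, t]`). [folklore] -/
def recentRecollisionCount (G : Geometry d X) (ε : ℝ) (γ : ℝ → Config N d X) (α M : ℝ)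
    (i : Fin N) (t : ℝ) : ℕ :=
  recollisionCount G ε γ i (t - M / α) t

section API

variable {G : Geometry d X} {ε : ℝ} {γ : ℝ → Config N d X} {i : Fin N} {s t : ℝ}

/-- The tagged particle belongs to its running cluster. [folklore] -/
theorem mem_backwardSweep_fst_self : i ∈ (backwardSweep G ε γ i s t).1 :=
  fst_subset_sweep_fst _ _ (Finset.mem_singleton_self i)

/-- The tagged particle is not a member of its backward cluster (APST 2015 §5: "`J_i` does not
include `i` itself"). [cite: AokiPulvirentiSimonellaTsuji2015, §5] -/
theorem not_mem_backwardCluster_self : i ∉ backwardCluster G ε γ i s t :=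
  Finset.notMem_erase i _

/-- The running cluster is the tagged particle together with its backward cluster. [folklore] -/
theorem backwardSweep_fst_eq_insert :
    (backwardSweep G ε γ i s t).1 = insert i (backwardCluster G ε γ i s t) := by
  rw [backwardCluster, Finset.insert_erase mem_backwardSweep_fst_self]

/-- Membership in the backward cluster. [folklore] -/
theorem mem_backwardCluster_iff {k : Fin N} :
    k ∈ backwardCluster G ε γ i s t ↔ k ≠ i ∧ k ∈ (backwardSweep G ε γ i s t).1 :=
  Finset.mem_erase

/-- A backward cluster has at most `N - 1` members (APST 2015 §5: `0 ≤ K_i ≤ N - 1`).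
[cite: AokiPulvirentiSimonellaTsuji2015, §5] -/
theorem card_backwardCluster_le : (backwardCluster G ε γ i s t).card ≤ N - 1 := by
  have h : backwardCluster G ε γ i s t ⊆ Finset.univ.erase i := fun k hk =>
    Finset.mem_erase.2 ⟨(mem_backwardCluster_iff.1 hk).1, Finset.mem_univ k⟩
  refine (Finset.card_le_card h).trans ?_
  rw [Finset.card_erase_of_mem (Finset.mem_univ i), Finset.card_univ, Fintype.card_fin]

/-- With no collision in the window the running cluster is the tagged particle alone and there
is no recollision. [folklore] -/
theorem backwardSweep_of_collisionWindow_eq_empty (h : collisionWindow G ε γ s t = ∅) :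
    backwardSweep G ε γ i s t = ({i}, 0) := by
  simp [backwardSweep, collisionEvents, h]

/-- With no collision in the window the backward cluster is empty. [folklore] -/
theorem backwardCluster_of_collisionWindow_eq_empty (h : collisionWindow G ε γ s t = ∅) :
    backwardCluster G ε γ i s t = ∅ := by
  rw [backwardCluster, backwardSweep_of_collisionWindow_eq_empty h]
  simp

/-- With no collision in the window there is no recollision. [folklore] -/
theorem recollisionCount_of_collisionWindow_eq_empty (h : collisionWindow G ε γ s t = ∅) :
    recollisionCount G ε γ i s t = 0 := by
  rw [recollisionCount, backwardSweep_of_collisionWindow_eq_empty h]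

/-- Over an empty time window (`t ≤ s`) the backward cluster is empty. [folklore] -/
theorem backwardCluster_of_le (hts : t ≤ s) : backwardCluster G ε γ i s t = ∅ :=
  backwardCluster_of_collisionWindow_eq_empty (collisionWindow_eq_empty_of_le hts)

/-- Over an empty time window (`t ≤ s`) there is no recollision. [folklore] -/
theorem recollisionCount_of_le (hts : t ≤ s) : recollisionCount G ε γ i s t = 0 :=
  recollisionCount_of_collisionWindow_eq_empty (collisionWindow_eq_empty_of_le hts)

/-- The collision record has one entry per pair in contact at each collision time of the
window. [folklore] -/
theorem card_collisionRecord :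
    (collisionRecord G ε γ s t).card =
      ∑ τ ∈ collisionWindow G ε γ s t, (contactPairSet G ε (γ τ)).card := by
  classical
  rw [collisionRecord, Finset.card_filter, Finset.sum_product]
  refine Finset.sum_congr rfl fun τ _ => ?_
  simp only [Finset.sum_boole, Nat.cast_id, Finset.filter_univ_mem]

/-- The number of recollisions is at most the number of recorded collisions `(τ, {p, q})` in
the window. [folklore] -/
theorem recollisionCount_le_card_collisionRecord :
    recollisionCount G ε γ i s t ≤ (collisionRecord G ε γ s t).card := by
  classical
  -- the recollision count of a sweep is bounded by the total number of pairs in its events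
  have key : ∀ (L : List ℝ) (init : Finset (Fin N) × ℕ),
      (sweep (L.map fun τ => contactPairSet G ε (γ τ)) init).2 ≤
        init.2 + (L.map fun τ => (contactPairSet G ε (γ τ)).card).sum := by
    intro L init
    induction L with
    | nil => simp
    | cons τ L ih =>
      simp only [List.map_cons, sweep_cons, sweepStep, List.sum_cons]
      have := recollisionStep_le_card (contactPairSet G ε (γ τ))
        (sweep (L.map fun τ => contactPairSet G ε (γ τ)) init).1
      omega
  have hperm := ((collisionWindow G ε γ s t).sort_perm_toList (· ≤ ·)).map
    fun τ => (contactPairSet G ε (γ τ)).card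
  rw [card_collisionRecord, ← Finset.sum_map_toList, ← hperm.sum_eq]
  simpa [recollisionCount, backwardSweep, collisionEvents] using
    key ((collisionWindow G ε γ s t).sort) ({i}, 0)

end API

/-! ## Single-pair events: each collision is a creation, a recollision, or external -/

/-- A backward step over a single pair `{p, q}` either adds one new member (exactly one of
`p, q` already belongs to the running cluster: a *creation*), or counts one recollision (both
belong), or does nothing (neither belongs). [folklore] -/
theorem card_clusterStep_add_recollisionStep_singleton_le (e : Sym2 (Fin N))
    (S : Finset (Fin N)) : (clusterStep {e} S).card + recollisionStep {e} S ≤ S.card + 1 := by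
  classical
  induction e using Sym2.ind with
  | h p q =>
    have hrec : recollisionStep {s(p, q)} S ≤ 1 := by
      simpa using recollisionStep_le_card {s(p, q)} S
    by_cases hboth : p ∈ S ∧ q ∈ S
    · -- a recollision: the running cluster does not change
      have hT : clusterStep {s(p, q)} S = S := by
        refine Finset.Subset.antisymm (fun k hk => ?_) (subset_clusterStep _ _)
        rcases mem_clusterStep.1 hk with hk | ⟨j, -, hjk⟩
        · exact hk
        · rcases Sym2.eq_iff.1 (Finset.mem_singleton.1 hjk) with ⟨-, rfl⟩ | ⟨-, rfl⟩
          · exact hboth.2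
          · exact hboth.1
      rw [hT]
      omega
    · -- no recollision; at most one new member
      have hR : recollisionStep {s(p, q)} S = 0 := by
        rw [recollisionStep, Finset.card_eq_zero, Finset.filter_singleton, if_neg]
        intro hall
        exact hboth ⟨hall p (Sym2.mem_mk_left p q), hall q (Sym2.mem_mk_right p q)⟩
      have hT : clusterStep {s(p, q)} S ⊆ insert (if p ∈ S then q else p) S := by
        intro k hk
        rcases mem_clusterStep.1 hk with hk | ⟨j, hj, hjk⟩
        · exact Finset.mem_insert_of_mem hk
        · rw [Finset.mem_insert]
          left
          rcases Sym2.eq_iff.1 (Finset.mem_singleton.1 hjk) with ⟨rfl, rfl⟩ | ⟨rfl, rfl⟩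
          · rw [if_pos hj]
          · rw [if_neg fun hp => hboth ⟨hp, hj⟩]
      rw [hR, add_zero]
      exact (Finset.card_le_card hT).trans (Finset.card_insert_le _ _)

/-- Along a sweep over events with at most one pair each, the number of members plus the
number of recollisions grows by at most one per event. [folklore] -/
theorem card_add_snd_sweep_le (Es : List (Finset (Sym2 (Fin N)))) (hEs : ∀ E ∈ Es, E.card ≤ 1)
    (init : Finset (Fin N) × ℕ) :
    (sweep Es init).1.card + (sweep Es init).2 ≤ init.1.card + init.2 + Es.length := by
  induction Es with
  | nil => simp
  | cons E Es ih =>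
    have ih' := ih fun E' hE' => hEs E' (List.mem_cons_of_mem _ hE')
    have hE := hEs E List.mem_cons_self
    rw [sweep_cons, List.length_cons]
    rcases Nat.le_one_iff_eq_zero_or_eq_one.1 hE with h0 | h1
    · rw [Finset.card_eq_zero.1 h0, sweepStep_empty]
      omega
    · obtain ⟨e, rfl⟩ := Finset.card_eq_one.1 h1
      have := card_clusterStep_add_recollisionStep_singleton_le e (sweep Es init).1
      simp only [sweepStep]
      omega

/-! ## Windows compose -/

section Window

variable {G : Geometry d X} {ε : ℝ} {γ : ℝ → Config N d X} {i : Fin N}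

/-- Sorting a finite set of reals that splits into a lower and an upper part. [folklore] -/
theorem sort_union_of_forall_lt {A B : Finset ℝ} (h : ∀ a ∈ A, ∀ b ∈ B, a < b) :
    (A ∪ B).sort = A.sort ++ B.sort := by
  refine (Finset.sortedLT_sort _).eq_of_mem_iff ?_ fun a => by simp
  rw [List.sortedLT_iff_pairwise, List.pairwise_append]
  exact ⟨(Finset.sortedLT_sort A).pairwise, (Finset.sortedLT_sort B).pairwise,
    fun a ha b hb => h a ((Finset.mem_sort _).1 ha) b ((Finset.mem_sort _).1 hb)⟩

/-- The collision window over `(s', t]` splits at any intermediate time `s`. [folklore] -/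
theorem collisionWindow_eq_union {s' s t : ℝ} (hs's : s' ≤ s) (hst : s ≤ t)
    (hfin : (collisionTimes G ε γ ∩ Ioc s' t).Finite) :
    collisionWindow G ε γ s' t = collisionWindow G ε γ s' s ∪ collisionWindow G ε γ s t := by
  have hfin₁ : (collisionTimes G ε γ ∩ Ioc s' s).Finite :=
    hfin.subset (inter_subset_inter_right _ (Ioc_subset_Ioc_right hst))
  have hfin₂ : (collisionTimes G ε γ ∩ Ioc s t).Finite :=
    hfin.subset (inter_subset_inter_right _ (Ioc_subset_Ioc_left hs's))
  ext τ
  rw [Finset.mem_union, mem_collisionWindow hfin, mem_collisionWindow hfin₁,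
    mem_collisionWindow hfin₂, ← Ioc_union_Ioc_eq_Ioc hs's hst, mem_union, and_or_left]

/-- The collision events over `(s', t]` are those over `(s', s]` followed by those over
`(s, t]`. [folklore] -/
theorem collisionEvents_eq_append {s' s t : ℝ} (hs's : s' ≤ s) (hst : s ≤ t)
    (hfin : (collisionTimes G ε γ ∩ Ioc s' t).Finite) :
    collisionEvents G ε γ s' t = collisionEvents G ε γ s' s ++ collisionEvents G ε γ s t := by
  rw [collisionEvents, collisionWindow_eq_union hs's hst hfin, sort_union_of_forall_lt,
    List.map_append, collisionEvents, collisionEvents]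
  intro a ha b hb
  exact (mem_of_mem_collisionWindow ha).2.2.trans_lt (mem_of_mem_collisionWindow hb).2.1

/-- Going further back in time continues the backward sweep ("iterate this procedure up to
time `0`", APST 2015 §1). [cite: AokiPulvirentiSimonellaTsuji2015, §1] -/
theorem backwardSweep_eq_sweep {s' s t : ℝ} (hs's : s' ≤ s) (hst : s ≤ t)
    (hfin : (collisionTimes G ε γ ∩ Ioc s' t).Finite) :
    backwardSweep G ε γ i s' t =
      sweep (collisionEvents G ε γ s' s) (backwardSweep G ε γ i s t) := by
  rw [backwardSweep, collisionEvents_eq_append hs's hst hfin, sweep_append, backwardSweep]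

/-- The backward cluster grows as the window is extended into the past. [folklore] -/
theorem backwardCluster_mono_left {s' s t : ℝ} (hs's : s' ≤ s)
    (hfin : (collisionTimes G ε γ ∩ Ioc s' t).Finite) :
    backwardCluster G ε γ i s t ⊆ backwardCluster G ε γ i s' t := by
  rcases le_or_gt s t with hst | hts
  · intro k hk
    rw [mem_backwardCluster_iff] at hk ⊢
    refine ⟨hk.1, ?_⟩
    rw [backwardSweep_eq_sweep hs's hst hfin]
    exact fst_subset_sweep_fst _ _ hk.2
  · rw [backwardCluster_of_le hts.le]
    exact Finset.empty_subset _

/-- The recollision count grows as the window is extended into the past. [folklore] -/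
theorem recollisionCount_mono_left {s' s t : ℝ} (hs's : s' ≤ s)
    (hfin : (collisionTimes G ε γ ∩ Ioc s' t).Finite) :
    recollisionCount G ε γ i s t ≤ recollisionCount G ε γ i s' t := by
  rcases le_or_gt s t with hst | hts
  · rw [recollisionCount, recollisionCount, backwardSweep_eq_sweep hs's hst hfin]
    exact snd_le_sweep_snd _ _
  · rw [recollisionCount_of_le hts.le]
    exact Nat.zero_le _

end Window

/-! ## Along hard-sphere trajectories -/

section Trajectory

variable [TopologicalSpace X] {G : Geometry d X} {ε : ℝ} {γ : ℝ → Config N d X} {i : Fin N}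
  {s t : ℝ}

/-- A hard-sphere trajectory has finitely many collision times in every window `(s, t]`
(local copy of `IsHardSphereTrajectory.finite_collisionTimes_inter_Ioc` of
`Literature.Analysis.FluidPDE.CollisionalTransfer`, not imported here). [folklore] -/
private theorem finite_window (h : IsHardSphereTrajectory G ε N γ) (s t : ℝ) :
    (collisionTimes G ε γ ∩ Ioc s t).Finite :=
  (h.locFinite s t).subset (inter_subset_inter_right _ Ioc_subset_Icc_self)

/-- Membership in the collision window of a hard-sphere trajectory. [folklore] -/
theorem _root_.Literature.Analysis.FluidPDE.IsHardSphereTrajectory.mem_collisionWindow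
    (h : IsHardSphereTrajectory G ε N γ) {τ : ℝ} :
    τ ∈ collisionWindow G ε γ s t ↔ τ ∈ collisionTimes G ε γ ∧ τ ∈ Ioc s t :=
  KineticTheory.mem_collisionWindow (finite_window h s t)

/-- Two-element finsets and unordered pairs. [folklore] -/
theorem sym2Mk_eq_of_pair_eq {j k p q : Fin N} (h : ({j, k} : Finset (Fin N)) = {p, q}) :
    s(j, k) = s(p, q) := by
  have h' : ({j, k} : Set (Fin N)) = {p, q} := by rw [← Finset.coe_pair, ← Finset.coe_pair, h]
  exact Sym2.eq_iff.2 (Set.pair_eq_pair_iff.1 h')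

/-- Along a hard-sphere trajectory a single pair collides at a time: the event at a contact of
the pair `{p, q}` is the singleton `{{p, q}}` (`IsHardSphereTrajectory.binary`; GST 2013
Prop. 4.1.1: multiple collisions are excluded). [folklore] -/
theorem _root_.Literature.Analysis.FluidPDE.IsHardSphereTrajectory.contactPairSet_eq_singleton
    (h : IsHardSphereTrajectory G ε N γ) {τ : ℝ} {p q : Fin N} (hpq : p ≠ q)
    (hc : γ τ ∈ contactSet G N ε p q) : contactPairSet G ε (γ τ) = {s(p, q)} := by
  obtain ⟨huniq, -⟩ := h.binary τ p q hpq hc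
  ext e
  induction e using Sym2.ind with
  | h j k =>
    rw [Finset.mem_singleton, mem_contactPairSet]
    constructor
    · rintro ⟨hjk, hc' | hc'⟩
      · exact sym2Mk_eq_of_pair_eq (huniq j k hjk hc')
      · exact Sym2.eq_swap.trans (sym2Mk_eq_of_pair_eq (huniq k j (fun h' => hjk h'.symm) hc'))
    · intro he
      rcases Sym2.eq_iff.1 he with ⟨rfl, rfl⟩ | ⟨rfl, rfl⟩
      · exact ⟨hpq, Or.inl hc⟩
      · exact ⟨fun h' => hpq h'.symm, Or.inr hc⟩

/-- At a collision time of a hard-sphere trajectory exactly one pair is in contact. [folklore] -/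
theorem _root_.Literature.Analysis.FluidPDE.IsHardSphereTrajectory.card_contactPairSet_eq_one
    (h : IsHardSphereTrajectory G ε N γ) {τ : ℝ} (hτ : τ ∈ collisionTimes G ε γ) :
    (contactPairSet G ε (γ τ)).card = 1 := by
  obtain ⟨p, q, hpq, hc⟩ := mem_collisionTimes.1 hτ
  rw [h.contactPairSet_eq_singleton hpq hc, Finset.card_singleton]

/-- Every event of a hard-sphere trajectory in a window is a single pair. [folklore] -/
theorem _root_.Literature.Analysis.FluidPDE.IsHardSphereTrajectory.card_of_mem_collisionEvents
    (h : IsHardSphereTrajectory G ε N γ) {E : Finset (Sym2 (Fin N))}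
    (hE : E ∈ collisionEvents G ε γ s t) : E.card = 1 := by
  obtain ⟨τ, hτ, rfl⟩ := List.mem_map.1 hE
  exact h.card_contactPairSet_eq_one (mem_of_mem_collisionWindow ((Finset.mem_sort _).1 hτ)).1

/-- The collision record of a hard-sphere trajectory has one entry `(t_m, {p_m, q_m})` per
collision time (APST 2015 §5). [cite: AokiPulvirentiSimonellaTsuji2015, §5] -/
theorem _root_.Literature.Analysis.FluidPDE.IsHardSphereTrajectory.card_collisionRecord
    (h : IsHardSphereTrajectory G ε N γ) :
    (collisionRecord G ε γ s t).card = (collisionWindow G ε γ s t).card := by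
  rw [KineticTheory.card_collisionRecord, Finset.card_eq_sum_ones]
  refine Finset.sum_congr rfl fun τ hτ => ?_
  exact h.card_contactPairSet_eq_one (mem_of_mem_collisionWindow hτ).1

/-- **Creations plus recollisions are collisions**: along a hard-sphere trajectory, the
cardinality of the backward cluster (the number of collisions of the cluster involving a new
particle) plus the number of recollisions is at most the number of collisions in the window
(PS 2021 §1.1). [cite: PulvirentiSimonella2021, §1.1] -/
theorem _root_.Literature.Analysis.FluidPDE.IsHardSphereTrajectory.card_add_recollisionCount_le
    (h : IsHardSphereTrajectory G ε N γ) :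
    (backwardCluster G ε γ i s t).card + recollisionCount G ε γ i s t ≤
      (collisionWindow G ε γ s t).card := by
  have key := card_add_snd_sweep_le (collisionEvents G ε γ s t)
    (fun E hE => (h.card_of_mem_collisionEvents hE).le) ({i}, 0)
  rw [length_collisionEvents] at key
  have hcard : (backwardCluster G ε γ i s t).card + 1 = (backwardSweep G ε γ i s t).1.card := by
    rw [backwardCluster, Finset.card_erase_add_one mem_backwardSweep_fst_self]
  simp only [backwardSweep, Finset.card_singleton] at key hcard
  rw [recollisionCount, backwardSweep]
  omega

/-- Along a hard-sphere trajectory the backward cluster grows as the window is extended into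
the past. [folklore] -/
theorem _root_.Literature.Analysis.FluidPDE.IsHardSphereTrajectory.backwardCluster_mono_left
    (h : IsHardSphereTrajectory G ε N γ) {s' : ℝ} (hs's : s' ≤ s) :
    backwardCluster G ε γ i s t ⊆ backwardCluster G ε γ i s' t :=
  KineticTheory.backwardCluster_mono_left hs's (finite_window h s' t)

/-- Along a hard-sphere trajectory the recollision count grows as the window is extended into
the past. [folklore] -/
theorem _root_.Literature.Analysis.FluidPDE.IsHardSphereTrajectory.recollisionCount_mono_left
    (h : IsHardSphereTrajectory G ε N γ) {s' : ℝ} (hs's : s' ≤ s) :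
    recollisionCount G ε γ i s t ≤ recollisionCount G ε γ i s' t :=
  KineticTheory.recollisionCount_mono_left hs's (finite_window h s' t)

end Trajectory

/-! ## Along the hard-sphere flow: functions of the initial datum -/

section Flow

variable [MeasureSpace X] [TopologicalSpace X] {G : Geometry d X} {ε : ℝ}

open scoped Classical in
/-- The backward cluster of the tagged particle `i` over the window `(s, t]` as a function of
the initial datum `z` of the hard-sphere flow `Φ` (APST 2015 §1: "the backward cluster of
particle 1 at time `t` and for the initial configuration `Z_N`" is `Φ.backwardCluster 1 0 t`).
Off the good set of the flow (a Liouville-null set where the dynamics is not defined) the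
value is the junk value `∅`. [cite: AokiPulvirentiSimonellaTsuji2015, §1] -/
def _root_.Literature.Analysis.FluidPDE.HardSphereFlow.backwardCluster (Φ : HardSphereFlow G ε N)
    (i : Fin N) (s t : ℝ) (z : Config N d X) : Finset (Fin N) :=
  if z ∈ Φ.good then KineticTheory.backwardCluster G ε (fun τ => Φ.flow τ z) i s t else ∅

open scoped Classical in
/-- The number of recollisions of the backward cluster of `i` over `(s, t]` as a function of the
initial datum of the flow (PS 2021 §1.1); junk value `0` off the good set.
[cite: PulvirentiSimonella2021, §1.1] -/
def _root_.Literature.Analysis.FluidPDE.HardSphereFlow.recollisionCount (Φ : HardSphereFlow G ε N)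
    (i : Fin N) (s t : ℝ) (z : Config N d X) : ℕ :=
  if z ∈ Φ.good then KineticTheory.recollisionCount G ε (fun τ => Φ.flow τ z) i s t else 0

/-- The backward cluster over the last `M` mean free times `(t - M/α, t]` along the flow
(`α` the collision rate). [folklore] -/
def _root_.Literature.Analysis.FluidPDE.HardSphereFlow.recentBackwardCluster
    (Φ : HardSphereFlow G ε N) (α M : ℝ) (i : Fin N) (t : ℝ) (z : Config N d X) :
    Finset (Fin N) :=
  Φ.backwardCluster i (t - M / α) t z

/-- The recollision count over the last `M` mean free times `(t - M/α, t]` along the flow.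
[folklore] -/
def _root_.Literature.Analysis.FluidPDE.HardSphereFlow.recentRecollisionCount
    (Φ : HardSphereFlow G ε N) (α M : ℝ) (i : Fin N) (t : ℝ) (z : Config N d X) : ℕ :=
  Φ.recollisionCount i (t - M / α) t z

/-- The mean cardinality `⟨K⟩` of the backward cluster of `i` over `(s, t]` under the initial
law `P₀` (APST 2015 §1: `⟨K⟩_t`, the average of `K = |J|` with respect to the initial
distribution, is the case `s = 0`). [cite: AokiPulvirentiSimonellaTsuji2015, §1] -/
def _root_.Literature.Analysis.FluidPDE.HardSphereFlow.meanBackwardClusterCard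
    (Φ : HardSphereFlow G ε N) (P₀ : Measure (Config N d X)) (i : Fin N) (s t : ℝ) : ℝ :=
  ∫ z, ((Φ.backwardCluster i s t z).card : ℝ) ∂P₀

/-- The mean number of recollisions of the backward cluster of `i` over `(s, t]` under the
initial law `P₀`. [folklore] -/
def _root_.Literature.Analysis.FluidPDE.HardSphereFlow.meanRecollisionCount
    (Φ : HardSphereFlow G ε N) (P₀ : Measure (Config N d X)) (i : Fin N) (s t : ℝ) : ℝ :=
  ∫ z, (Φ.recollisionCount i s t z : ℝ) ∂P₀

variable (Φ : HardSphereFlow G ε N) {i : Fin N} {s t : ℝ} {z : Config N d X}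

/-- On the good set the flow version is the backward cluster of the orbit. [folklore] -/
theorem _root_.Literature.Analysis.FluidPDE.HardSphereFlow.backwardCluster_apply (hz : z ∈ Φ.good) :
    Φ.backwardCluster i s t z = KineticTheory.backwardCluster G ε (fun τ => Φ.flow τ z) i s t := by
  unfold HardSphereFlow.backwardCluster
  exact if_pos hz

/-- On the good set the flow version is the recollision count of the orbit. [folklore] -/
theorem _root_.Literature.Analysis.FluidPDE.HardSphereFlow.recollisionCount_apply
    (hz : z ∈ Φ.good) :
    Φ.recollisionCount i s t z =
      KineticTheory.recollisionCount G ε (fun τ => Φ.flow τ z) i s t := by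
  unfold HardSphereFlow.recollisionCount
  exact if_pos hz

/-- Off the good set the backward cluster is the junk value `∅`. [folklore] -/
theorem _root_.Literature.Analysis.FluidPDE.HardSphereFlow.backwardCluster_apply_of_not_mem
    (hz : z ∉ Φ.good) : Φ.backwardCluster i s t z = ∅ := by
  unfold HardSphereFlow.backwardCluster
  exact if_neg hz

/-- Off the good set the recollision count is the junk value `0`. [folklore] -/
theorem _root_.Literature.Analysis.FluidPDE.HardSphereFlow.recollisionCount_apply_of_not_mem
    (hz : z ∉ Φ.good) : Φ.recollisionCount i s t z = 0 := by
  unfold HardSphereFlow.recollisionCount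
  exact if_neg hz

/-- The tagged particle never belongs to its own backward cluster. [folklore] -/
theorem _root_.Literature.Analysis.FluidPDE.HardSphereFlow.not_mem_backwardCluster_self
    : i ∉ Φ.backwardCluster i s t z := by
  by_cases hz : z ∈ Φ.good
  · rw [Φ.backwardCluster_apply hz]
    exact KineticTheory.not_mem_backwardCluster_self
  · rw [Φ.backwardCluster_apply_of_not_mem hz]
    exact Finset.notMem_empty i

/-- A backward cluster has at most `N - 1` members. [folklore] -/
theorem _root_.Literature.Analysis.FluidPDE.HardSphereFlow.card_backwardCluster_le
    : (Φ.backwardCluster i s t z).card ≤ N - 1 := by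
  by_cases hz : z ∈ Φ.good
  · rw [Φ.backwardCluster_apply hz]
    exact KineticTheory.card_backwardCluster_le
  · rw [Φ.backwardCluster_apply_of_not_mem hz, Finset.card_empty]
    exact Nat.zero_le _

/-- Creations plus recollisions are at most the collisions of the orbit in the window. [folklore] -/
theorem _root_.Literature.Analysis.FluidPDE.HardSphereFlow.card_add_recollisionCount_le
    (hz : z ∈ Φ.good) :
    (Φ.backwardCluster i s t z).card + Φ.recollisionCount i s t z ≤
      (collisionWindow G ε (fun τ => Φ.flow τ z) s t).card := by
  rw [Φ.backwardCluster_apply hz, Φ.recollisionCount_apply hz]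
  exact (Φ.isTrajectory z hz).card_add_recollisionCount_le

/-- The backward cluster along the flow grows as the window is extended into the past. [folklore] -/
theorem _root_.Literature.Analysis.FluidPDE.HardSphereFlow.backwardCluster_mono_left
    {s' : ℝ} (hs's : s' ≤ s) :
    Φ.backwardCluster i s t z ⊆ Φ.backwardCluster i s' t z := by
  by_cases hz : z ∈ Φ.good
  · rw [Φ.backwardCluster_apply hz, Φ.backwardCluster_apply hz]
    exact (Φ.isTrajectory z hz).backwardCluster_mono_left hs's
  · rw [Φ.backwardCluster_apply_of_not_mem hz]
    exact Finset.empty_subset _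

/-- The recollision count along the flow grows as the window is extended into the past.
[folklore] -/
theorem _root_.Literature.Analysis.FluidPDE.HardSphereFlow.recollisionCount_mono_left
    {s' : ℝ} (hs's : s' ≤ s) :
    Φ.recollisionCount i s t z ≤ Φ.recollisionCount i s' t z := by
  by_cases hz : z ∈ Φ.good
  · rw [Φ.recollisionCount_apply hz, Φ.recollisionCount_apply hz]
    exact (Φ.isTrajectory z hz).recollisionCount_mono_left hs's
  · rw [Φ.recollisionCount_apply_of_not_mem hz]
    exact Nat.zero_le _

/-- The mean cluster cardinality is nonnegative. [folklore] -/
theorem _root_.Literature.Analysis.FluidPDE.HardSphereFlow.meanBackwardClusterCard_nonneg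
    (P₀ : Measure (Config N d X)) :
    0 ≤ Φ.meanBackwardClusterCard P₀ i s t :=
  integral_nonneg fun _ => Nat.cast_nonneg _

/-- The mean recollision count is nonnegative. [folklore] -/
theorem _root_.Literature.Analysis.FluidPDE.HardSphereFlow.meanRecollisionCount_nonneg
    (P₀ : Measure (Config N d X)) :
    0 ≤ Φ.meanRecollisionCount P₀ i s t :=
  integral_nonneg fun _ => Nat.cast_nonneg _

end Flow

end

end Literature.MathematicalPhysics.KineticTheory
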